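import Mathlib
import HarnessLib
import Literature.Analysis.FluidPDE.SelfSimilar
import Literature.Analysis.FluidPDE.VectorCalculus
import Literature.Analysis.FluidPDE.VorticityCalculus
import Literature.Analysis.FluidPDE.TaoEnstrophyLocalisation
import Literature.Analysis.FluidPDE.NSBoundedMildOseen
import Literature.Analysis.FluidPDE.SuitableWeak
import Literature.Analysis.FluidPDE.WeakSolution
import Literature.Analysis.FluidPDE.LocalTypeI
import Literature.Analysis.UnboundedOperators.HeatKernel
import Summits.NavierStokesRegularity.NavierStokesRegularity.Theorems.LocalSineTubeDoorProfileAlignedWindowRigidityAncient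

/-!
# `FilamentPinchDoor.FilamentaryGrowth` (stmt-NavierStokesRegularity-26431) — line `birth`,
# stub `stub_signedMassOfSliceEnergy` PROVED: a one-signed vorticity component of a slice with linear
# energy growth on balls has linear (FILAMENTARY) mass growth on balls

Registered stub of the skeleton of record (planner ns-idea-6 g3 birth skeleton, stub statement
`StubSignedMassOfSliceEnergy` unfolded into the theorem header by the lead; skeleton r1), VERBATIM.

STATEMENT.  For a profile `v` of the route's class (Type-I rate, continuous on the open slab, Oseen-mild,
divergence-free, suitable on the backward slab with `𝐈 < ∞`) whose slices obey `∫_{B(x,R)} ‖v(s)‖² ≤ A·R`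
for all `s<0`, `x`, `R>0`, and a direction `e ≠ 0` with `⟪curl v(s,y), e⟫ ≥ 0` everywhere, there is `K` with
`∫_{B(x,R)} ⟪curl v(s,y), e⟫ dy ≤ K·R` for all `s < 0`, `x`, `R > 0` (in `ℝ≥0∞` form).

PROOF (the kinematic heart of the crux; the energy class enters only through the slice bound).  Slices of the
class are real-analytic (tree `…LocalSineTubeDoorProfileAlignedWindowRigidityAncient.analyticOnNhd_slice`:
Lemarié-Rieusset 2016 Thm 9.12 + bounded-mild uniqueness, PROVED in the tree), so `w = v(s)` is `C¹`.  Take a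
fixed smooth bump `φ₁` (`= 1` on `B₁(0)`, supported in `B₂(0)`, `‖∇φ₁‖ ≤ L`) and `φ(y) = φ₁((y − x)/R)`, so
`φ = 1` on `B(x,R)`, `supp φ ⊆ B̄(x,2R)`, `‖∇φ‖ ≤ L/R`.  Since `ω_e = ⟪curl w, e⟫ ≥ 0`,
`∫_{B(x,R)} ω_e ≤ ∫ φ ω_e = ∫ ⟪w, ∇φ × e⟫` (integration by parts for the curl against the compactly supported
field `φ e`, tree `integral_mul_inner_curl_eq`; the constant field `e` is curl-free), and pointwise
`⟪w, ∇φ × e⟫ ≤ ‖curlCLM‖ (L/R) ‖e‖ ‖w‖` on `B̄(x,2R)`, zero outside.  With `‖w‖ ≤ (R/2)‖w‖² + 1/(2R)`,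
`∫_{B̄(x,2R)} ‖w‖² ≤ ∫_{B(x,3R)} ‖w‖² ≤ 3AR` and `|B̄(x,2R)| = 8c₃R³` this is
`≤ ‖curlCLM‖ L ‖e‖ (3A/2 + 4c₃) · R`.  This is the scale-invariant 3-D form of the classical circulation
estimate for vorticity of distinguished sign (Majda–Bertozzi 2002, §11.4.2).

HONEST FRAMING: a statement about HYPOTHETICAL blow-up profiles (slices of a putative Type-I singularity's
energy-class profile); nothing here bears on Navier–Stokes regularity; no summit statement is proved.
-/

noncomputable section

-- the summit and its single sub-problem share the name (CONVENTIONS §1), as in every Theorems file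
set_option linter.dupNamespace false

namespace Summit.NavierStokesRegularity.NavierStokesRegularity.Theorems.FilamentPinchDoorFilamentaryGrowthStubSignedMassOfSliceEnergy

open Set Function Filter MeasureTheory Metric Topology InnerProductSpace
open scoped ENNReal NNReal RealInnerProductSpace
open Literature.Analysis Literature.Analysis.FluidPDE
open Summit.NavierStokesRegularity.NavierStokesRegularity.Theorems.LocalSineTubeDoorProfileAlignedWindowRigidityAncient

/-! ### A scaled family of cutoffs with gradient `O(1/R)` -/

/-- **Scaled cutoffs.** There is `L ≥ 0` such that for every centre `x` and radius `R > 0` there is a `C¹`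
compactly supported `φ ≥ 0` with `φ = 1` on `B(x,R)`, `∇φ = 0` off `B̄(x,2R)` and `‖∇φ‖ ≤ L/R` everywhere
(`φ(y) = φ₁((y−x)/R)` for a fixed smooth bump `φ₁`, `L = sup ‖∇φ₁‖`). [folklore] -/
theorem exists_scaledBump :
    ∃ L : ℝ, 0 ≤ L ∧ ∀ (x : EuclideanSpace ℝ (Fin 3)) (R : ℝ), 0 < R →
      ∃ φ : EuclideanSpace ℝ (Fin 3) → ℝ, ContDiff ℝ 1 φ ∧ HasCompactSupport φ ∧
        (∀ y ∈ ball x R, φ y = 1) ∧ (∀ y, 0 ≤ φ y) ∧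
        (∀ y, y ∉ closedBall x (2 * R) → fderiv ℝ φ y = 0) ∧
        (∀ y, ‖fderiv ℝ φ y‖ ≤ L / R) := by
  let φ₁ : ContDiffBump (0 : EuclideanSpace ℝ (Fin 3)) := ⟨1, 2, one_pos, one_lt_two⟩
  have hφ₁d : ContDiff ℝ 1 φ₁ := φ₁.contDiff
  have hDc : Continuous (fderiv ℝ φ₁) := hφ₁d.continuous_fderiv one_ne_zero
  have hDs : HasCompactSupport (fderiv ℝ (φ₁ : EuclideanSpace ℝ (Fin 3) → ℝ)) :=
    φ₁.hasCompactSupport.fderiv (𝕜 := ℝ)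
  obtain ⟨L, hL⟩ := hDs.exists_bound_of_continuous hDc
  have hL0 : 0 ≤ L := (norm_nonneg _).trans (hL 0)
  refine ⟨L, hL0, fun x R hR => ?_⟩
  -- the affine rescaling `A y = R⁻¹ • (y - x)`
  set A : EuclideanSpace ℝ (Fin 3) → EuclideanSpace ℝ (Fin 3) := fun y => R⁻¹ • (y - x) with hA
  have hAn : ∀ y, ‖A y‖ = dist y x / R := fun y => by
    rw [hA]
    simp only
    rw [norm_smul, Real.norm_eq_abs, abs_of_pos (inv_pos.2 hR), dist_eq_norm]
    ring
  have hAd : ∀ y, HasFDerivAt A (R⁻¹ • ContinuousLinearMap.id ℝ (EuclideanSpace ℝ (Fin 3))) y :=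
    fun y => ((hasFDerivAt_id y).sub_const x).const_smul R⁻¹
  have hAc : ContDiff ℝ 1 A := (contDiff_id.sub contDiff_const).const_smul R⁻¹
  refine ⟨fun y => φ₁ (A y), hφ₁d.comp hAc, ?_, ?_, fun y => φ₁.nonneg, ?_, ?_⟩
  · -- compact support: zero off `B̄(x, 2R)`
    refine HasCompactSupport.intro (isCompact_closedBall x (2 * R)) fun y hy => ?_
    refine φ₁.zero_of_le_dist ?_
    rw [dist_zero_right, hAn]
    rw [mem_closedBall, not_le] at hy
    rw [le_div_iff₀ hR]
    exact hy.le
  · -- `= 1` on `B(x, R)`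
    intro y hy
    refine φ₁.one_of_mem_closedBall ?_
    rw [mem_closedBall, dist_zero_right, hAn]
    rw [mem_ball] at hy
    rw [div_le_iff₀ hR, one_mul]
    exact hy.le
  · -- gradient vanishes off `B̄(x, 2R)`
    intro y hy
    refine fderiv_of_notMem_tsupport ℝ ?_
    have hsupp : support (fun y => φ₁ (A y)) ⊆ ball x (2 * R) := by
      intro z hz
      rw [mem_support] at hz
      rw [mem_ball]
      by_contra hz'
      rw [not_lt] at hz'
      refine hz (φ₁.zero_of_le_dist ?_)
      rw [dist_zero_right, hAn, le_div_iff₀ hR]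
      exact hz'
    have hts : tsupport (fun y => φ₁ (A y)) ⊆ closedBall x (2 * R) :=
      (closure_mono hsupp).trans closure_ball_subset_closedBall
    exact fun h => hy (hts h)
  · -- gradient bound `‖∇φ‖ ≤ L / R`
    intro y
    have hd : HasFDerivAt (fun y => φ₁ (A y))
        ((fderiv ℝ φ₁ (A y)).comp (R⁻¹ • ContinuousLinearMap.id ℝ (EuclideanSpace ℝ (Fin 3)))) y :=
      ((hφ₁d.differentiable one_ne_zero) (A y)).hasFDerivAt.comp y (hAd y)
    rw [hd.fderiv]
    calc ‖(fderiv ℝ φ₁ (A y)).comp (R⁻¹ • ContinuousLinearMap.id ℝ (EuclideanSpace ℝ (Fin 3)))‖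
        ≤ ‖fderiv ℝ φ₁ (A y)‖ * ‖R⁻¹ • ContinuousLinearMap.id ℝ (EuclideanSpace ℝ (Fin 3))‖ :=
          ContinuousLinearMap.opNorm_comp_le _ _
      _ ≤ L * (R⁻¹ * 1) := by
          refine mul_le_mul (hL _) ?_ (norm_nonneg _) hL0
          rw [norm_smul, Real.norm_eq_abs, abs_of_pos (inv_pos.2 hR)]
          exact mul_le_mul_of_nonneg_left ContinuousLinearMap.norm_id_le (inv_pos.2 hR).le
      _ = L / R := by ring

/-! ### The kinematic estimate on one slice -/

/-- **Signed vorticity mass from local energy (one slice).**  For a `C¹` field `w` on `ℝ³` with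
`⟪curl w, e⟫ ≥ 0` everywhere and `∫_{B(x,r)} ‖w‖² ≤ A·r` for all `r > 0` (at the centre `x`), and a cutoff
`φ` as in `exists_scaledBump`, `∫_{B(x,R)} ⟪curl w, e⟫ ≤ ‖curlCLM‖ · L · ‖e‖ · (3A/2 + 4c₃) · R`, where
`c₃ = |B₁(0)|`: test `ω_e` against `φ`, integrate the curl by parts onto `φ e` (`∫ φ ω_e = ∫ ⟪w, ∇φ × e⟫`),
bound `‖w‖ ≤ (R/2)‖w‖² + 1/(2R)` on `B̄(x,2R) ⊆ B(x,3R)`.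
[cite: MajdaBertozzi2002, §11.4.2 (circulation of one-signed vorticity controlled by local kinetic energy)] -/
theorem lintegral_ball_inner_curl_le {w : EuclideanSpace ℝ (Fin 3) → EuclideanSpace ℝ (Fin 3)}
    (hw : ContDiff ℝ 1 w) {e : EuclideanSpace ℝ (Fin 3)} (hnn : ∀ y, 0 ≤ ⟪curl w y, e⟫)
    {x : EuclideanSpace ℝ (Fin 3)} {A : ℝ} (hA0 : 0 ≤ A)
    (hA : ∀ r : ℝ, 0 < r → ∫⁻ y in ball x r, ENNReal.ofReal (‖w y‖ ^ 2) ≤ ENNReal.ofReal (A * r))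
    {R : ℝ} (hR : 0 < R) {φ : EuclideanSpace ℝ (Fin 3) → ℝ} (hφ : ContDiff ℝ 1 φ)
    (hφc : HasCompactSupport φ) (hφ1 : ∀ y ∈ ball x R, φ y = 1) (hφ0 : ∀ y, 0 ≤ φ y)
    (hφs : ∀ y, y ∉ closedBall x (2 * R) → fderiv ℝ φ y = 0) {L : ℝ}
    (hL : ∀ y, ‖fderiv ℝ φ y‖ ≤ L / R) :
    ∫⁻ y in ball x R, ENNReal.ofReal ⟪curl w y, e⟫ ≤
      ENNReal.ofReal (‖curlCLM‖ * L * ‖e‖ *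
        (3 / 2 * A + 4 * (volume (ball (0 : EuclideanSpace ℝ (Fin 3)) 1)).toReal) * R) := by
  set c₃ : ℝ := (volume (ball (0 : EuclideanSpace ℝ (Fin 3)) 1)).toReal with hc₃
  have hLR : 0 ≤ L / R := (norm_nonneg _).trans (hL x)
  set Λ : ℝ := ‖curlCLM‖ * (L / R * ‖e‖) with hΛ
  have hΛ0 : 0 ≤ Λ := by positivity
  -- the paired field `g = ⟪w, ∇φ × e⟫`
  set g : EuclideanSpace ℝ (Fin 3) → ℝ := fun y => ⟪w y, curlCLM ((fderiv ℝ φ y).smulRight e)⟫ with hg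
  have hcurlw : Continuous (curl w) := continuous_curl hw
  have hsr : Continuous fun y => (fderiv ℝ φ y).smulRight e :=
    ((hφ.fderiv_right (m := 0) (by norm_num)).smulRight contDiff_const).continuous
  have hgc : Continuous g := hw.continuous.inner (curlCLM.continuous.comp hsr)
  -- Step C: integration by parts, `∫ φ ω_e = ∫ g`
  have hC : ∫ y, φ y * ⟪curl w y, e⟫ = ∫ y, g y := by
    have h := integral_mul_inner_curl_eq (W := fun _ => e) hw contDiff_const hφ hφc
    have h0 : ∀ y, curl (fun _ : EuclideanSpace ℝ (Fin 3) => e) y = 0 := fun y =>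
      curl_eq_zero_of_fderiv_eq_zero (by simp)
    simp_rw [h0, inner_zero_right, mul_zero, integral_zero, zero_add] at h
    exact h
  -- pointwise bound and support of `g`
  have hg_le : ∀ y, g y ≤ Λ * ‖w y‖ := fun y => by
    calc g y ≤ ‖w y‖ * ‖curlCLM ((fderiv ℝ φ y).smulRight e)‖ := real_inner_le_norm _ _
      _ ≤ ‖w y‖ * (‖curlCLM‖ * (‖fderiv ℝ φ y‖ * ‖e‖)) := by
          gcongr; exact norm_curlCLM_smulRight_le _ _
      _ ≤ ‖w y‖ * (‖curlCLM‖ * (L / R * ‖e‖)) := by gcongr; exact hL y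
      _ = Λ * ‖w y‖ := by rw [hΛ]; ring
  have hg0 : ∀ y, y ∉ closedBall x (2 * R) → g y = 0 := fun y hy => by
    simp [hg, hφs y hy]
  -- AM–GM: `‖w‖ ≤ (R/2)‖w‖² + 1/(2R)`
  have hamgm : ∀ y, Λ * ‖w y‖ ≤ Λ * (R / 2 * ‖w y‖ ^ 2 + 1 / (2 * R)) := fun y => by
    refine mul_le_mul_of_nonneg_left ?_ hΛ0
    have h2R : 0 < 2 * R := by positivity
    have key : R / 2 * ‖w y‖ ^ 2 + 1 / (2 * R) - ‖w y‖ = (R * ‖w y‖ - 1) ^ 2 / (2 * R) := by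
      field_simp
      ring
    have h : 0 ≤ (R * ‖w y‖ - 1) ^ 2 / (2 * R) := div_nonneg (sq_nonneg _) h2R.le
    linarith
  -- Step D: `∫ g ≤ Λ ((R/2)·3AR + (1/(2R))·|B̄(x,2R)|)`
  set S : Set (EuclideanSpace ℝ (Fin 3)) := closedBall x (2 * R) with hS
  have hSc : IsCompact S := isCompact_closedBall x (2 * R)
  have hSm : MeasurableSet S := measurableSet_closedBall
  have hvolS : volume.real S = (2 * R) ^ 3 * c₃ := by
    rw [measureReal_def, hS, Measure.addHaar_closedBall volume x (by positivity : (0 : ℝ) ≤ 2 * R),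
      ENNReal.toReal_mul, ENNReal.toReal_ofReal (by positivity), finrank_euclideanSpace_fin]
  have hS3 : S ⊆ ball x (3 * R) := fun y hy => by
    rw [hS, mem_closedBall] at hy
    rw [mem_ball]
    linarith
  -- `∫_S ‖w‖² ≤ 3 A R`
  have hw2c : Continuous fun y => ‖w y‖ ^ 2 := (hw.continuous.norm).pow 2
  have hE : ∫ y in S, ‖w y‖ ^ 2 ≤ A * (3 * R) := by
    have h1 : ∫ y in S, ‖w y‖ ^ 2 ≤ ∫ y in ball x (3 * R), ‖w y‖ ^ 2 :=
      setIntegral_mono_set (hw2c.continuousOn.integrableOn_compact (isCompact_closedBall x (3 * R))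
          |>.mono_set ball_subset_closedBall)
        (Eventually.of_forall fun y => sq_nonneg _) (Eventually.of_forall hS3)
    have h2 : ∫ y in ball x (3 * R), ‖w y‖ ^ 2 =
        (∫⁻ y in ball x (3 * R), ENNReal.ofReal (‖w y‖ ^ 2)).toReal :=
      integral_eq_lintegral_of_nonneg_ae (Eventually.of_forall fun y => sq_nonneg _)
        hw2c.aestronglyMeasurable
    have h3 : (∫⁻ y in ball x (3 * R), ENNReal.ofReal (‖w y‖ ^ 2)).toReal ≤ A * (3 * R) :=
      ENNReal.toReal_le_of_le_ofReal (by positivity) (hA (3 * R) (by positivity))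
    linarith
  have hgi : IntegrableOn g S volume := hgc.continuousOn.integrableOn_compact hSc
  have hri : IntegrableOn (fun y => Λ * (R / 2 * ‖w y‖ ^ 2 + 1 / (2 * R))) S volume :=
    (continuous_const.mul ((continuous_const.mul hw2c).add continuous_const)).continuousOn
      |>.integrableOn_compact hSc
  have hD : ∫ y, g y ≤ Λ * (R / 2 * (A * (3 * R)) + 1 / (2 * R) * ((2 * R) ^ 3 * c₃)) := by
    rw [← setIntegral_eq_integral_of_forall_compl_eq_zero (s := S) (fun y hy => hg0 y hy)]
    calc ∫ y in S, g y ≤ ∫ y in S, Λ * (R / 2 * ‖w y‖ ^ 2 + 1 / (2 * R)) :=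
          setIntegral_mono_on hgi hri hSm fun y _ => (hg_le y).trans (hamgm y)
      _ = Λ * (R / 2 * (∫ y in S, ‖w y‖ ^ 2) + 1 / (2 * R) * volume.real S) := by
          rw [integral_const_mul, integral_add, integral_const_mul, setIntegral_const, smul_eq_mul]
          · ring
          · exact (hw2c.continuousOn.integrableOn_compact hSc).const_mul _
          · exact (integrableOn_const_iff).2 (Or.inr hSc.measure_lt_top)
      _ ≤ Λ * (R / 2 * (A * (3 * R)) + 1 / (2 * R) * ((2 * R) ^ 3 * c₃)) := by
          rw [hvolS]; gcongr
  -- Steps A, B, E: back to `ℝ≥0∞`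
  have hint : Integrable (fun y => φ y * ⟪curl w y, e⟫) (volume : Measure (EuclideanSpace ℝ (Fin 3))) :=
    (hφ.continuous.mul (hcurlw.inner continuous_const)).integrable_of_hasCompactSupport hφc.mul_right
  have hnn' : 0 ≤ᵐ[volume] fun y => φ y * ⟪curl w y, e⟫ :=
    Eventually.of_forall fun y => mul_nonneg (hφ0 y) (hnn y)
  calc ∫⁻ y in ball x R, ENNReal.ofReal ⟪curl w y, e⟫
      = ∫⁻ y in ball x R, ENNReal.ofReal (φ y * ⟪curl w y, e⟫) :=
        setLIntegral_congr_fun measurableSet_ball fun y hy => by rw [hφ1 y hy, one_mul]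
    _ ≤ ∫⁻ y, ENNReal.ofReal (φ y * ⟪curl w y, e⟫) := setLIntegral_le_lintegral _ _
    _ = ENNReal.ofReal (∫ y, φ y * ⟪curl w y, e⟫) := (ofReal_integral_eq_lintegral_ofReal hint hnn').symm
    _ ≤ ENNReal.ofReal (‖curlCLM‖ * L * ‖e‖ * (3 / 2 * A + 4 * c₃) * R) := by
        refine ENNReal.ofReal_le_ofReal ?_
        rw [hC]
        refine hD.trans (le_of_eq ?_)
        rw [hΛ]
        field_simp
        ring

/-- **Stub `stub_signedMassOfSliceEnergy` of line `birth` (crux `FilamentaryGrowth`, stmt-26431), VERBATIM**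
(the planner's `StubSignedMassOfSliceEnergy` unfolded): for a profile of the route's energy class with linear slice
energy growth `∫_{B(x,R)} ‖v(s)‖² ≤ A·R` and a one-signed vorticity component `⟪curl v(s), e⟫ ≥ 0`, the signed
mass has FILAMENTARY growth `∫_{B(x,R)} ⟪curl v(s), e⟫ ≤ K·R` uniformly in `s < 0`, `x`, `R > 0`, with
`K = ‖curlCLM‖ · L · ‖e‖ · (3|A|/2 + 4|B₁|)` (analytic slices + `lintegral_ball_inner_curl_le`).  The Oseen-mild
identity is used only for slice smoothness; `π`, `H`, suitability, `𝐈` and `e ≠ 0` are carried, not used.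
[cite: MajdaBertozzi2002, §11.4.2 (circulation of one-signed vorticity controlled by local kinetic energy)] -/
theorem stub_signedMassOfSliceEnergy : ∀ (C : ℝ) (v : ℝ → EuclideanSpace ℝ (Fin 3) → EuclideanSpace ℝ (Fin 3)) (π : ℝ → EuclideanSpace ℝ (Fin 3) → ℝ) (H : ℝ → EuclideanSpace ℝ (Fin 3) → EuclideanSpace ℝ (Fin 3) →L[ℝ] EuclideanSpace ℝ (Fin 3)), Literature.Analysis.FluidPDE.HasTypeITimeDecay C v → ContinuousOn (Function.uncurry v) (Set.Iio (0 : ℝ) ×ˢ Set.univ) → (∀ s t : ℝ, s < t → t < 0 → ∀ x, v t x = Literature.Analysis.UnboundedOperators.heatExtension (v s) (t - s) x - Literature.Analysis.FluidPDE.oseenDuhamel 1 s v v t x) → (∀ t < 0, Literature.Analysis.FluidPDE.VectorCalculus.IsDivFree (v t)) → Literature.Analysis.FluidPDE.IsSuitableWeakSolutionOn (Literature.Analysis.FluidPDE.slab (EuclideanSpace ℝ (Fin 3)) (Set.Iio (0 : ℝ)) isOpen_Iio) 1 0 v π → Literature.Analysis.FluidPDE.HasWeakSpatialGradientOn (Literature.Analysis.FluidPDE.slab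 (EuclideanSpace ℝ (Fin 3)) (Set.Iio (0 : ℝ)) isOpen_Iio) v H → Literature.Analysis.FluidPDE.typeIBound (Set.Iio (0 : ℝ) ×ˢ Set.univ) v π H < ⊤ → (∃ A : ℝ, ∀ s < 0, ∀ (x : EuclideanSpace ℝ (Fin 3)) (R : ℝ), 0 < R → ∫⁻ y in Metric.ball x R, ENNReal.ofReal (‖v s y‖ ^ 2) ≤ ENNReal.ofReal (A * R)) → ∀ (e : EuclideanSpace ℝ (Fin 3)), e ≠ 0 → (∀ s < 0, ∀ y, 0 ≤ ⟪Literature.Analysis.FluidPDE.curl (v s) y, e⟫_ℝ) → (∃ K : ℝ, ∀ s < 0, ∀ (x : EuclideanSpace ℝ (Fin 3)) (R : ℝ), 0 < R → ∫⁻ y in Metric.ball x R, ENNReal.ofReal ⟪Literature.Analysis.FluidPDE.curl (v s) y, e⟫_ℝ ≤ ENNReal.ofReal (K * R)) := by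
  intro C v π H hrate hcont hmild _ _ _ _ hAex e _ hnn
  obtain ⟨A, hA⟩ := hAex
  obtain ⟨L, _, hbump⟩ := exists_scaledBump
  refine ⟨‖curlCLM‖ * L * ‖e‖ *
    (3 / 2 * |A| + 4 * (volume (ball (0 : EuclideanSpace ℝ (Fin 3)) 1)).toReal), fun s hs x R hR => ?_⟩
  have hw : ContDiff ℝ 1 (v s) :=
    (analyticOnNhd_slice hcont (bdd_of_hasTypeITimeDecay hrate) hmild hs).contDiff
  obtain ⟨φ, hφ, hφc, hφ1, hφ0, hφs, hφL⟩ := hbump x R hR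
  have hA' : ∀ r : ℝ, 0 < r →
      ∫⁻ y in ball x r, ENNReal.ofReal (‖v s y‖ ^ 2) ≤ ENNReal.ofReal (|A| * r) := fun r hr =>
    (hA s hs x r hr).trans (ENNReal.ofReal_le_ofReal
      (mul_le_mul_of_nonneg_right (le_abs_self A) hr.le))
  exact lintegral_ball_inner_curl_le hw (hnn s hs) (abs_nonneg A) hA' hR hφ hφc hφ1 hφ0 hφs hφL

end Summit.NavierStokesRegularity.NavierStokesRegularity.Theorems.FilamentPinchDoorFilamentaryGrowthStubSignedMassOfSliceEnergy

end
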